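import Mathlib
import Summits.ResolutionOfSingularities.ResolutionOfSingularities.Theorems.HomologicalConductorPersistenceStaircaseRecords
import Summits.ResolutionOfSingularities.ResolutionOfSingularities.Theorems.HomologicalConductorPersistenceCyclicQuotientPlusTwoModQStair
import HarnessLib

/-!
# Rung S-2 `PersistenceSurface` (stmt-19970), stub C1 (`Sat₄`) — the family `1/n(1,q)`, `n = bq + 2` (`q` odd ≥ 3):
# `ca(k[u,v]^{μ_n(1,q)}) = ca⁴ = ⋂_{d odd ≤ q} s̲ann(M_{−d})`, kernel-certified UNIFORMLY in `(b, q)` — PART B: assembly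
# (chain W4.4b; T-V package, part 30b; seat leafhand-res-homologicalconduct-10 gen 2)

[OURS · L1 w44b · rung S-2] Nothing here is a statement of the manuscript under review (Hironaka 2017);
AI-written, weaker than expert review.

`U = k[u,v]^{μ_n(1,q)}`, `n = bq + 2`, `b ≥ 1`, `q = 2h+1 ≥ 3` (`ζ` a primitive `n`-th root of unity, `n ∈ kˣ`):
`n/q = [b+1, 2, …, 2, 3]`, `e = h + 1`, `i`-series = all odd numbers `≤ q`, so the distinguished family is `{M_{−(2t+1)} : t ≤ h}`
— of UNBOUNDED size — and `Ω M_a ≅ M_{−q}^{A} ⊕ M_{−ρ}` (`ρ` odd) resp. `M_{−q}^{A} ⊕ M_{−(ρ−1)} ⊕ M_{−1}` (`ρ ≥ 2` even),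
`M_0 = U` for `ρ = 0` beyond the `q`-drops (two-level recursion `(n,q) → (q, q−2)` of the hand memo HAND10G2-TORIC-FAMILIES §1).
Ω-stability: `M_{−q} | Ω M_{−1}` (position `0`) and `M_{−(2t+1)} | Ω M_{−(q−2t)}` (position `b − 1`) for `t < h`.

* **`cohomologyAnnihilator_plusTwo_mod_q`** — for every `b ≥ 1`, odd `q ≥ 3`, `n = bq + 2`: `ca(U) = ca⁴(U)` and
  `x ∈ ca(U) ↔ x ∈ ⋂_{t ≤ (q−1)/2} s̲ann(M_{−(2t+1)})`.

With parts 23–29 this puts `Sat₄` in the kernel for every cyclic quotient `1/n(1,q)` with `n ≡ ±1, ±2 (mod q)` (up to `u ↔ v`).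
The cover property and the ring identities are part A (`…CyclicQuotientPlusTwoModQStair`).

References: folklore (Auslander 1986 / Herzog 1978 mechanism; Wunram 1988, Riemenschneider 1974); hand memo HAND10G2-TORIC-FAMILIES
(OURS, evidence on stmt-19970).
-/

-- single-problem summit: the doubled namespace component `ResolutionOfSingularities` is forced
set_option linter.dupNamespace false

noncomputable section

open CategoryTheory Literature.RingTheory.CohomologyAnnihilator MvPolynomial
open Summit.ResolutionOfSingularities.ResolutionOfSingularities.Theorems.NoZeno.SandwichCluster
open Summit.ResolutionOfSingularities.ResolutionOfSingularities.Theorems.HomologicalConductor.PersistenceAddCoverFamily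
open Summit.ResolutionOfSingularities.ResolutionOfSingularities.Theorems.HomologicalConductor.PersistenceCyclicQuotientIsotypic
open Summit.ResolutionOfSingularities.ResolutionOfSingularities.Theorems.HomologicalConductor.PersistenceCyclicQuotientIsotypicPieces
open Summit.ResolutionOfSingularities.ResolutionOfSingularities.Theorems.HomologicalConductor.PersistenceStaircaseRecords
open Summit.ResolutionOfSingularities.ResolutionOfSingularities.Theorems.HomologicalConductor.PersistenceCyclicQuotientOneModQ
  (natCast_val_add_mul_self val_sub_natCast_eq val_neg_natCast)

universe u

namespace Summit.ResolutionOfSingularities.ResolutionOfSingularities.Theorems.HomologicalConductor.PersistenceCyclicQuotientPlusTwoModQ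

variable {k : Type u} [Field k] {n : ℕ} [NeZero n] {ζ : k} (hζ : IsPrimitiveRoot ζ n) (hn : (n : k) ≠ 0)
variable {q : ℕ} (U : Subalgebra k (MvPolynomial (Fin 2) k))
variable (hU : ∀ p, p ∈ U ↔ aeval (fun i : Fin 2 => C (ζ ^ (![1, q] : Fin 2 → ℕ) i) * X i) p = p)

set_option maxHeartbeats 1600000 in
set_option synthInstance.maxHeartbeats 400000 in
include hζ hn hU in
/-- **`Sat₄` and the exact centre for `k[u,v]^{μ_n(1,q)}` whenever `n = bq + 2` (`b ≥ 1`, `q ≥ 3` odd), kernel-certified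
uniformly in `(b, q)`.**  With the weight pieces `M a = {p | σ₀ p = ζ^a p}` (`σ₀ : u ↦ ζu, v ↦ ζ^{q}v`): `ca(U) = ca⁴(U)` and
`x ∈ ca(U) ↔ x` stably annihilates every `M_{−(2t+1)}`, `t ≤ (q−1)/2` (the duals of the specials; `i`-series = the odd numbers
`≤ q`).  (Budgets raised locally as in parts 21–29.) [OURS · L1 w44b] -/
theorem cohomologyAnnihilator_plusTwo_mod_q (b : ℕ) (hb : 1 ≤ b) (hq : 3 ≤ q) (hqodd : q % 2 = 1)
    (hnq : n = b * q + 2) :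
    ∃ M : ZMod n → Submodule U ((restrictScalarsFunctor U (MvPolynomial (Fin 2) k)).obj
        (ModuleCat.of (MvPolynomial (Fin 2) k) (MvPolynomial (Fin 2) k))),
      (∀ (a : ZMod n) (p : MvPolynomial (Fin 2) k),
        (show ((restrictScalarsFunctor U (MvPolynomial (Fin 2) k)).obj
          (ModuleCat.of (MvPolynomial (Fin 2) k) (MvPolynomial (Fin 2) k))) from p) ∈ M a ↔
        aeval (fun i : Fin 2 => C (ζ ^ (![1, q] : Fin 2 → ℕ) i) * X i) p = C (ζ ^ a.val) * p) ∧
      cohomologyAnnihilator U = cohomologyAnnihilatorOfDegree U 4 ∧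
      ∀ x : U, x ∈ cohomologyAnnihilator U ↔
        ∀ t : Fin (q / 2 + 1), StablyAnnihilates U x
          (@ModuleCat.of U _ (M (-((2 * (t : ℕ) + 1 : ℕ) : ZMod n))) _ (M (-((2 * (t : ℕ) + 1 : ℕ) : ZMod n))).module) := by
  classical
  set h := q / 2 with hh
  have hqh : q = 2 * h + 1 := by omega
  have hh1 : 1 ≤ h := by omega
  have hbq : q ≤ b * q := Nat.le_mul_of_pos_left q (by omega)
  have hcop : Nat.Coprime q n := by
    -- `n = bq + 2` and `q` is odd
    rw [hnq]
    refine (Nat.coprime_mul_right_add_right q 2 b).mpr ?_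
    rw [Nat.coprime_two_right]
    exact Nat.odd_iff.mpr hqodd
  obtain ⟨M, hM, ⟨e⟩⟩ := exists_isotypic_splitting hζ hn hcop U hU
  have hval : ∀ a : ZMod n, a.val < n := fun a => ZMod.val_lt a
  have hdm : ∀ a : ZMod n, q * (a.val / q) + a.val % q = a.val := fun a => Nat.div_add_mod _ _
  have hml : ∀ a : ZMod n, a.val % q < q := fun a => Nat.mod_lt _ (by omega)
  -- per-class staircase data, `α = qA + ρ`, `r = ρ / 2`
  let A : ZMod n → ℕ := fun a => a.val / q
  let ρ : ZMod n → ℕ := fun a => a.val % q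
  let r : ZMod n → ℕ := fun a => a.val % q / 2
  let μ : ZMod n → ℕ := fun a => A a + (if ρ a = 0 then 0 else if ρ a % 2 = 1 then 1 else 2)
  let J : ZMod n → ℕ := fun a => if ρ a = 0 then A a else if ρ a % 2 = 1 then A a + b * (h - r a) + 1
    else A a + b * (h - r a + 1) + 1 + b * h + 1
  let c : ZMod n → ℕ → ℕ := fun a s =>
    if s ≤ A a then a.val - q * s else if ρ a % 2 = 1 then 0 else if s = A a + 1 then (if ρ a = 0 then 0 else 1) else 0
  let j : ZMod n → ℕ → ℕ := fun a s =>
    if s ≤ A a then s else if ρ a = 0 then A a else if ρ a % 2 = 1 then A a + b * (h - r a) + 1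
      else if s = A a + 1 then A a + b * (h - r a + 1) + 1 else A a + b * (h - r a + 1) + 1 + b * h + 1
  let d : ZMod n → ℕ → ZMod n := fun a t =>
    if t < A a then -((2 * h + 1 : ℕ) : ZMod n) else if ρ a % 2 = 1 then -((ρ a : ℕ) : ZMod n)
      else if t < A a + 1 then -((ρ a - 1 : ℕ) : ZMod n) else -((1 : ℕ) : ZMod n)
  have hc_anti : ∀ a, Antitone (c a) := by
    intro a s t hst
    have hA := hdm a
    have h1 : s ≤ a.val / q → q * s ≤ q * (a.val / q) := fun h => Nat.mul_le_mul_left q h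
    have h2 := Nat.mul_le_mul_left q hst
    dsimp only [c, A, ρ]
    split_ifs <;> omega
  have hj_mono : ∀ a, Monotone (j a) := by
    intro a s t hst
    dsimp only [j, A, ρ, r]
    split_ifs <;> omega
  -- the `J₂` bookkeeping: `A + b(h−r+1) + 1 + bh + 1 = A + b(2h−r+1) + 2`
  have hJ₂ : ∀ a : ZMod n, a.val / q + b * (h - a.val % q / 2 + 1) + 1 + b * h + 1 =
      a.val / q + b * (2 * h - a.val % q / 2 + 1) + 2 := by
    intro a
    have := hml a
    rw [show 2 * h - a.val % q / 2 + 1 = (h - a.val % q / 2 + 1) + h by omega, Nat.mul_add b (h - a.val % q / 2 + 1) h]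
    omega
  -- the class of every generator
  have hcl : ∀ a s, ((c a s + q * j a s : ℕ) : ZMod n) = a := by
    intro a s
    have hA := hdm a
    have hρq := hml a
    dsimp only [c, j, A, ρ, r]
    by_cases hs : s ≤ a.val / q
    · have := Nat.mul_le_mul_left q hs
      rw [if_pos hs, if_pos hs, show a.val - q * s + q * s = a.val by omega, ZMod.natCast_zmod_val]
    · rw [if_neg hs, if_neg hs]
      by_cases h0 : a.val % q = 0
      · simp only [h0, Nat.zero_mod, Nat.zero_ne_one, if_false, if_true]
        split_ifs <;> rw [show 0 + q * (a.val / q) = a.val by omega, ZMod.natCast_zmod_val]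
      · simp only [h0, if_false]
        by_cases hodd : a.val % q % 2 = 1
        · simp only [hodd, if_true]
          rw [zero_add, odd_identity q b (a.val / q) (a.val % q / 2) h hqh (by omega),
            show q * (a.val / q) + (2 * (a.val % q / 2) + 1) = a.val by omega, ← hnq, natCast_val_add_mul_self]
        · simp only [hodd, if_false]
          by_cases hs1 : s = a.val / q + 1
          · simp only [hs1, if_true]
            rw [even₁_identity q b (a.val / q) (a.val % q / 2) h hqh (by omega),
              show q * (a.val / q) + 2 * (a.val % q / 2) = a.val by omega, ← hnq, natCast_val_add_mul_self]
          · simp only [hs1, if_false]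
            rw [zero_add, hJ₂ a, even₂_identity q b (a.val / q) (a.val % q / 2) h hqh (by omega),
              show q * (a.val / q) + 2 * (a.val % q / 2) = a.val by omega, ← hnq, natCast_val_add_mul_self]
  -- the drop classes
  have hψ : ∀ a t, t < μ a → d a t = a - ((c a t + q * j a (t + 1) : ℕ) : ZMod n) := by
    intro a t ht
    have hA := hdm a
    have hρq := hml a
    dsimp only [μ, A, ρ] at ht
    dsimp only [d, c, j, A, ρ, r]
    by_cases htA : t < a.val / q
    · have := Nat.mul_le_mul_left q (le_of_lt htA)
      rw [if_pos htA, if_pos (le_of_lt htA), if_pos (Nat.succ_le_of_lt htA), ← hqh,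
        show a.val - q * t + q * (t + 1) = a.val + q by rw [Nat.mul_succ]; omega, Nat.cast_add,
        ZMod.natCast_zmod_val]
      ring
    · have h0 : ¬ a.val % q = 0 := by intro h0; rw [if_pos h0] at ht; omega
      rw [if_neg h0] at ht
      simp only [h0, if_false]
      rw [if_neg htA, if_neg (show ¬ (t + 1 ≤ a.val / q) by omega)]
      have hαcast : ((a.val % q : ℕ) : ZMod n) = a - ((q * (a.val / q) : ℕ) : ZMod n) := by
        have := congrArg (Nat.cast : ℕ → ZMod n) hA
        rw [Nat.cast_add, ZMod.natCast_zmod_val] at this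
        linear_combination this
      by_cases hodd : a.val % q % 2 = 1
      · -- the single drop `−ρ` at `t = A`
        rw [if_pos hodd] at ht
        have ht0 : t = a.val / q := by omega
        simp only [hodd, if_true]
        rw [if_pos (le_of_eq ht0), ht0, show a.val - q * (a.val / q) = a.val % q by omega,
          odd_identity q b (a.val / q) (a.val % q / 2) h hqh (by omega),
          show q * (a.val / q) + (2 * (a.val % q / 2) + 1) = a.val by omega, ← hnq, Nat.cast_add,
          natCast_val_add_mul_self, hαcast]
        ring
      · rw [if_neg hodd] at ht
        simp only [hodd, if_false]
        by_cases ht1 : t < a.val / q + 1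
        · -- the drop `−(ρ−1)` at `t = A`
          have ht0 : t = a.val / q := by omega
          rw [if_pos ht1, if_pos (le_of_eq ht0), if_pos (by omega : t + 1 = a.val / q + 1), ht0,
            show a.val - q * (a.val / q) = a.val % q by omega,
            show a.val % q + q * (a.val / q + b * (h - a.val % q / 2 + 1) + 1) =
              (a.val % q - 1) + (1 + q * (a.val / q + b * (h - a.val % q / 2 + 1) + 1)) by omega,
            even₁_identity q b (a.val / q) (a.val % q / 2) h hqh (by omega),
            show q * (a.val / q) + 2 * (a.val % q / 2) = a.val by omega, ← hnq, Nat.cast_add,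
            natCast_val_add_mul_self]
          ring
        · -- the last drop `−1` at `t = A + 1`
          have ht0 : t = a.val / q + 1 := by omega
          rw [if_neg ht1, if_neg (show ¬ (t ≤ a.val / q) by omega), if_pos ht0,
            if_neg (show ¬ (t + 1 = a.val / q + 1) by omega), hJ₂ a,
            even₂_identity q b (a.val / q) (a.val % q / 2) h hqh (by omega),
            show q * (a.val / q) + 2 * (a.val % q / 2) = a.val by omega, ← hnq,
            show 1 + (a.val + (2 * h - a.val % q / 2 + 1) * n) = a.val + (2 * h - a.val % q / 2 + 1) * n + 1 by ring,
            Nat.cast_add, natCast_val_add_mul_self, Nat.cast_one]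
          ring
  -- `q J ≡ a`
  have hJ : ∀ a, ((q * J a : ℕ) : ZMod n) = a := by
    intro a
    have hA := hdm a
    have hρq := hml a
    dsimp only [J, A, ρ, r]
    by_cases h0 : a.val % q = 0
    · rw [if_pos h0, show q * (a.val / q) = a.val by omega, ZMod.natCast_zmod_val]
    · rw [if_neg h0]
      by_cases hodd : a.val % q % 2 = 1
      · rw [if_pos hodd, odd_identity q b (a.val / q) (a.val % q / 2) h hqh (by omega),
          show q * (a.val / q) + (2 * (a.val % q / 2) + 1) = a.val by omega, ← hnq, natCast_val_add_mul_self]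
      · rw [if_neg hodd, hJ₂ a, even₂_identity q b (a.val / q) (a.val % q / 2) h hqh (by omega),
          show q * (a.val / q) + 2 * (a.val % q / 2) = a.val by omega, ← hnq, natCast_val_add_mul_self]
  -- the cover property (part A)
  have hcov : ∀ a i, i ≤ J a → ∃ s, s ≤ μ a ∧ j a s ≤ i ∧ c a s ≤ ((a - ((q * i : ℕ) : ZMod n) : ZMod n)).val :=
    fun a i hi => cover_plusTwo_mod_q hqh hb hq hnq a i hi
  -- the staircase resolutions `Ω M_a ≅ Π_{t < μ a} M (d a t)`
  let M' : ZMod n → ModuleCat.{u} U := fun a => @ModuleCat.of U _ (M a) _ (M a).module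
  let K : ZMod n → ModuleCat.{u} U := fun a => ModuleCat.of U (Π t : Fin (μ a), M (d a t))
  have hK : ∀ a, IsSyzygy 1 (M' a) (K a) := by
    intro a
    refine isSyzygy_one_staircase_of_lt hζ U hU M hM a (μ a) (c a) (j a) (hc_anti a) (hj_mono a) (hcl a)
      (d a) (hψ a) ?_
    exact isotypic_le_span_of_cover hζ U hU M hM a (μ a) (J a) (c a) (j a) (hcl a) (hJ a) (hcov a)
  -- the certificate data: distinguished family `{M_{−(2t+1)} : t ≤ h}`
  let ψ' : Fin (q / 2 + 1) → ZMod n := fun t => -((2 * (t : ℕ) + 1 : ℕ) : ZMod n)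
  have hdψ : ∀ a t, t < μ a → ∃ s : Fin (q / 2 + 1), d a t = ψ' s := by
    intro a t ht
    have hρq := hml a
    dsimp only [μ, A, ρ] at ht
    dsimp only [d, A, ρ, ψ']
    by_cases htA : t < a.val / q
    · exact ⟨⟨h, by omega⟩, by rw [if_pos htA]⟩
    · rw [if_neg htA]
      have h0 : ¬ a.val % q = 0 := by intro h0; rw [if_pos h0] at ht; omega
      by_cases hodd : a.val % q % 2 = 1
      · refine ⟨⟨a.val % q / 2, by omega⟩, ?_⟩
        rw [if_pos hodd]
        exact congrArg (fun x : ℕ => -((x : ℕ) : ZMod n)) (show a.val % q = 2 * (a.val % q / 2) + 1 by omega)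
      · rw [if_neg hodd]
        by_cases ht1 : t < a.val / q + 1
        · refine ⟨⟨a.val % q / 2 - 1, by omega⟩, ?_⟩
          rw [if_pos ht1]
          exact congrArg (fun x : ℕ => -((x : ℕ) : ZMod n)) (show a.val % q - 1 = 2 * (a.val % q / 2 - 1) + 1 by omega)
        · refine ⟨⟨0, by omega⟩, ?_⟩
          rw [if_neg ht1]
          exact congrArg (fun x : ℕ => -((x : ℕ) : ZMod n)) (show 1 = 2 * 0 + 1 by norm_num)
  have hfin : ∀ t, Module.Finite U (M' (ψ' t)) := fun t => finite_isotypic hζ q U hU M hM _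
  have hKD : ∀ a, IsRetractOfPower (ModuleCat.of U ((Π t, M' (ψ' t)) × U)) (K a) := by
    intro a
    refine IsRetractOfPower.piFamily (fun t : Fin (μ a) => M' (d a t)) fun t => ?_
    obtain ⟨s, heq⟩ := hdψ a t t.isLt
    exact (isRetractOfPower_fst (ModuleCat.of U (Π t, M' (ψ' t))) (ModuleCat.of U U)).of_isRetractOfPower_gen
      ((isRetractOfPower_eval (fun t : Fin (q / 2 + 1) => M' (ψ' t)) s).of_iso
        (LinearEquiv.toModuleIso (LinearEquiv.ofEq _ _ (by rw [heq]))))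
  have hD : ∀ t, ∃ (s : Fin (q / 2 + 1)) (i : M' (ψ' t) ⟶ K (ψ' s)) (r : K (ψ' s) ⟶ M' (ψ' t)),
      i ≫ r = 𝟙 (M' (ψ' t)) := by
    -- sources: `M_{−q} | Ω M_{−1}` @0 (`α = n − 1 = bq + 1`, `A = b`, `ρ = 1`);
    -- `M_{−(2t+1)} | Ω M_{−(q − 2t)}` @(b−1) for `t < h` (`α = (b−1)q + (2t+2)`, even `ρ`)
    have hsrc : ∀ t : Fin (q / 2 + 1), ∃ (s : Fin (q / 2 + 1)) (p : Fin (μ (ψ' s))), d (ψ' s) p = ψ' t := by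
      intro t
      have ht := t.isLt
      by_cases hth : (t : ℕ) = h
      · let s : Fin (q / 2 + 1) := ⟨0, by omega⟩
        have hsval : (ψ' s).val = n - (2 * 0 + 1) := val_neg_natCast (by omega) (by omega)
        have hAρ : A (ψ' s) = b ∧ ρ (ψ' s) = 1 :=
          (Nat.div_mod_unique (by omega)).mpr ⟨by rw [hsval, hnq, Nat.mul_comm]; omega, by omega⟩
        have hμs : μ (ψ' s) = b + 1 := by
          simp only [μ, hAρ.1, hAρ.2, Nat.one_ne_zero, if_false, Nat.one_mod, if_true]
        refine ⟨s, ⟨0, by rw [hμs]; omega⟩, ?_⟩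
        change d (ψ' s) 0 = ψ' t
        simp only [d, hAρ.1]
        rw [if_pos (by omega)]
        change -((2 * h + 1 : ℕ) : ZMod n) = -((2 * (t : ℕ) + 1 : ℕ) : ZMod n)
        rw [hth]
      · have hth' : (t : ℕ) < h := by omega
        let s : Fin (q / 2 + 1) := ⟨h - t, by omega⟩
        have hsval : (ψ' s).val = n - (2 * (h - (t : ℕ)) + 1) := val_neg_natCast (by omega) (by omega)
        have hAρ : A (ψ' s) = b - 1 ∧ ρ (ψ' s) = 2 * (t : ℕ) + 2 := by
          refine (Nat.div_mod_unique (by omega)).mpr ⟨?_, by omega⟩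
          rw [hsval, hnq]
          obtain ⟨b', rfl⟩ : ∃ b', b = b' + 1 := ⟨b - 1, by omega⟩
          have hcomm : q * b' = b' * q := Nat.mul_comm _ _
          rw [Nat.add_sub_cancel, Nat.add_mul, one_mul]
          omega
        have hμs : μ (ψ' s) = b - 1 + 2 := by
          simp only [μ, hAρ.1, hAρ.2, Nat.succ_ne_zero, if_false]
          rw [if_neg (by omega)]
        refine ⟨s, ⟨b - 1, by rw [hμs]; omega⟩, ?_⟩
        change d (ψ' s) (b - 1) = ψ' t
        simp only [d, hAρ.1, hAρ.2, lt_irrefl, if_false]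
        rw [if_neg (by omega), if_pos (by omega), show 2 * (t : ℕ) + 2 - 1 = 2 * (t : ℕ) + 1 by omega]
    intro t
    obtain ⟨s, p, hp⟩ := hsrc t
    let E : M (d (ψ' s) p) ≃ₗ[U] M (ψ' t) := LinearEquiv.ofEq _ _ (by rw [hp])
    refine ⟨s,
      @ModuleCat.ofHom U _ (M (ψ' t)) (Π t' : Fin (μ (ψ' s)), M (d (ψ' s) t'))
        _ (M (ψ' t)).module _ _
        ((LinearMap.single U (fun t' : Fin (μ (ψ' s)) => M (d (ψ' s) t')) p) ∘ₗ E.symm.toLinearMap),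
      @ModuleCat.ofHom U _ (Π t' : Fin (μ (ψ' s)), M (d (ψ' s) t')) (M (ψ' t))
        _ _ _ (M (ψ' t)).module (E.toLinearMap ∘ₗ LinearMap.proj p), ?_⟩
    apply ModuleCat.hom_ext
    refine LinearMap.ext fun x => ?_
    change E ((Pi.single p (E.symm x) : Π t' : Fin (μ (ψ' s)), M (d (ψ' s) t')) p) = x
    rw [Pi.single_eq_same, LinearEquiv.apply_symm_apply]
  obtain ⟨h4, hiff⟩ := @cohomologyAnnihilator_eq_four_of_isotypicData k _ n _ ζ hζ hn q hcop U hU (Fin (q / 2 + 1)) _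
    M' e K hK ψ' hfin hKD hD
  exact ⟨M, hM, h4, hiff⟩

end Summit.ResolutionOfSingularities.ResolutionOfSingularities.Theorems.HomologicalConductor.PersistenceCyclicQuotientPlusTwoModQ

end
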